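import Literature.MathematicalPhysics.QuantumFieldTheory.OSSkeletonExplicitBounds
import Mathlib.Analysis.Calculus.BumpFunction.Normed
import HarnessLib

/-!
# Schwartz norms of bump profiles: scaling and coordinate multipliers (towards OS II Thm. 4.1 (4.5))

Topic `Literature/MathematicalPhysics/QuantumFieldTheory`; support file for the temperedness
estimate (4.5) of Osterwalder–Schrader II, Thm. 4.1. The density of the skeleton distribution
(`OSRegularisedDensityWindow.exists_holomorphic_density_skelDist_explicit`) is bounded through the
Schwartz norms `|φ|_M` of the profiles of the descendants of the base index `a₀ = (m⁻¹, χ, …, χ)`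
— bumps `χ` of radius `r₀` multiplied by coordinate functions `⟪·, w⟫` (the binary splitting
`coordMul`). This file bounds these norms by powers of `r₀⁻¹` and of `‖w‖`:

* `schwartzNorm_compCLM_invDilation_le` — `|N ∘ (w⁻¹ ·)|_M ≤ w^{-M} |N|_M` (`0 < w ≤ 1`);
* `schwartzNorm_coordMul_le` — **the coordinate multiplier bound** (Leibniz rule localised to the
  support): `|⟪·, c⟫ f|_M ≤ 2^M ‖c‖ (R + 1) |f|_M` for `f` supported in `B̄(0, R)`;
* `osBump`, `rawBumpS` — the (unnormalised) smooth bump of radius `r` as a Schwartz function, its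
  support, sign and mass (`vol B̄(0, r/2) ≤ ∫ χ_r`), the exact scaling `χ_r = χ₁ ∘ (r⁻¹ ·)`
  (`rawBumpS_eq_comp`) and `|χ_r|_M ≤ r^{-M} |χ₁|_M` (`schwartzNorm_rawBumpS_le`).

## References

* K. Osterwalder, R. Schrader, *Axioms for Euclidean Green's functions II*, Comm. Math. Phys.
  42 (1975) 281–305, Thm. 4.1 (4.5), Ch. VI.1 (6.12)–(6.13). [OsterwalderSchraderCMP1975]
-/

noncomputable section

open MeasureTheory Set Filter Module Metric
open _root_.Topology
open scoped InnerProductSpace RealInnerProductSpace SchwartzMap ContDiff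

namespace Literature.MathematicalPhysics.QuantumFieldTheory

open Literature.MathematicalPhysics.QuantumLattice (schwartzNorm)
open Literature.Analysis.Distribution

variable {V : Type*} [NormedAddCommGroup V] [InnerProductSpace ℝ V]

/-! ### Composition with the inverse dilation -/

/-- **Schwartz norms under the inverse dilation**: `|N ∘ (w⁻¹ ·)|_M ≤ w^{-M} |N|_M` for
`0 < w ≤ 1`. [folklore] -/
theorem schwartzNorm_compCLM_invDilation_le {w : ℝ} (hw0 : 0 < w) (hw1 : w ≤ 1) (N : 𝓢(V, ℂ)) (M : ℕ) :
    schwartzNorm M (SchwartzMap.compCLMOfContinuousLinearEquiv ℂ (invDilation hw0.ne') N) ≤ (w ^ M)⁻¹ * schwartzNorm M N := by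
  have hseminorm : ∀ k n : ℕ, SchwartzMap.seminorm ℂ k n (SchwartzMap.compCLMOfContinuousLinearEquiv ℂ (invDilation hw0.ne') N) ≤
      (w ^ n)⁻¹ * SchwartzMap.seminorm ℂ k n N := fun k n => by
    have hfg : SchwartzMap.compCLMOfContinuousLinearEquiv ℂ (invDilation hw0.ne') N =
        SchwartzMap.compCLMOfContinuousLinearEquiv ℝ (invDilation hw0.ne') N := by ext y; simp
    rw [hfg, ← seminorm_real_eq, ← seminorm_real_eq k n N]
    refine (Literature.Analysis.FunctionSpaces.seminorm_compCLMOfContinuousLinearEquiv_le _ N k n).trans ?_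
    have h1 : ‖(((invDilation hw0.ne').symm : V ≃L[ℝ] V) : V →L[ℝ] V)‖ ^ k ≤ 1 :=
      pow_le_one₀ (norm_nonneg _) ((norm_invDilation_symm_le hw0.ne').trans (by rwa [abs_of_pos hw0]))
    have h2 : ‖((invDilation hw0.ne' : V ≃L[ℝ] V) : V →L[ℝ] V)‖ ^ n ≤ (w ^ n)⁻¹ := by
      rw [← inv_pow]
      exact pow_le_pow_left₀ (norm_nonneg _) ((norm_invDilation_le hw0.ne').trans (by rw [abs_of_pos hw0])) n
    have h0 : 0 ≤ SchwartzMap.seminorm ℝ k n N := apply_nonneg _ _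
    calc ‖(((invDilation hw0.ne').symm : V ≃L[ℝ] V) : V →L[ℝ] V)‖ ^ k *
          ‖((invDilation hw0.ne' : V ≃L[ℝ] V) : V →L[ℝ] V)‖ ^ n * SchwartzMap.seminorm ℝ k n N
        ≤ 1 * (w ^ n)⁻¹ * SchwartzMap.seminorm ℝ k n N := by gcongr
      _ = (w ^ n)⁻¹ * SchwartzMap.seminorm ℝ k n N := by rw [one_mul]
  change ((Finset.Iic (M, M)).sup (schwartzSeminormFamily ℂ _ ℂ)) _ ≤ _
  have hN0 := QuantumLattice.schwartzNorm_nonneg M N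
  refine Seminorm.finset_sup_apply_le (by positivity) fun q hq => ?_
  rw [Finset.mem_Iic] at hq
  rw [SchwartzMap.schwartzSeminormFamily_apply]
  refine (hseminorm q.1 q.2).trans ?_
  have h1 : (w ^ q.2)⁻¹ ≤ (w ^ M)⁻¹ := by
    rw [inv_le_inv₀ (by positivity) (by positivity)]
    exact pow_le_pow_of_le_one hw0.le hw1 hq.2
  exact mul_le_mul h1 (QuantumLattice.seminorm_le_schwartzNorm hq.1 hq.2 N) (apply_nonneg _ _) (by positivity)

/-! ### The coordinate multiplier bound -/

/-- The coordinate function `y ↦ ⟪y, c⟫` (complex-valued) as a real continuous linear map. [folklore] -/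
def innerOfRealCLM (c : V) : V →L[ℝ] ℂ := Complex.ofRealCLM.comp (innerSL ℝ c)

/-- Values of `innerOfRealCLM`. [folklore] -/
@[simp]
theorem innerOfRealCLM_apply (c y : V) : innerOfRealCLM c y = ((⟪y, c⟫ : ℝ) : ℂ) := by
  simp [innerOfRealCLM, real_inner_comm]

/-- `‖innerOfRealCLM c‖ ≤ ‖c‖`. [folklore] -/
theorem norm_innerOfRealCLM_le (c : V) : ‖innerOfRealCLM c‖ ≤ ‖c‖ :=
  ContinuousLinearMap.opNorm_le_bound _ (norm_nonneg _) fun y => by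
    rw [innerOfRealCLM_apply, Complex.norm_real, Real.norm_eq_abs, mul_comm]
    exact abs_real_inner_le_norm y c

/-- **Derivatives of the coordinate function on a ball**: `‖Dᴺ ⟪·, c⟫ (x)‖ ≤ ‖c‖ (R + 1)` for
`‖x‖ ≤ R` (the value for `N = 0`, the functional for `N = 1`, zero beyond). [folklore] -/
theorem norm_iteratedFDeriv_inner_ofReal_le (c : V) {R : ℝ} (hR : 0 ≤ R) (N : ℕ) {x : V} (hx : x ∈ Metric.closedBall (0 : V) R) :
    ‖iteratedFDeriv ℝ N (fun y : V => ((⟪y, c⟫ : ℝ) : ℂ)) x‖ ≤ ‖c‖ * (R + 1) := by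
  have hfun : (fun y : V => ((⟪y, c⟫ : ℝ) : ℂ)) = innerOfRealCLM c := by
    funext y; rw [innerOfRealCLM_apply]
  rw [hfun]
  rw [Metric.mem_closedBall, dist_zero_right] at hx
  rcases N with _ | n
  · rw [norm_iteratedFDeriv_zero]
    calc ‖innerOfRealCLM c x‖ ≤ ‖innerOfRealCLM c‖ * ‖x‖ := (innerOfRealCLM c).le_opNorm x
      _ ≤ ‖c‖ * R := mul_le_mul (norm_innerOfRealCLM_le c) hx (norm_nonneg _) (norm_nonneg _)
      _ ≤ ‖c‖ * (R + 1) := by nlinarith [norm_nonneg c]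
  · have hfd : fderiv ℝ (⇑(innerOfRealCLM c)) = fun _ => innerOfRealCLM c := funext fun x => (innerOfRealCLM c).fderiv
    rw [← norm_iteratedFDeriv_fderiv, hfd]
    rcases n with _ | m
    · rw [norm_iteratedFDeriv_zero]
      calc ‖innerOfRealCLM c‖ ≤ ‖c‖ := norm_innerOfRealCLM_le c
        _ ≤ ‖c‖ * (R + 1) := by nlinarith [norm_nonneg c]
    · rw [iteratedFDeriv_const_of_ne (by omega), Pi.zero_apply, norm_zero]
      positivity

/-- **The coordinate multiplier bound, seminorm form** (Leibniz rule localised to the support):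
`p_{k,n}(⟪·, c⟫ f) ≤ 2ⁿ ‖c‖ (R + 1) sup_{(k',n') ≤ (k,n)} p_{k',n'}(f)` for `f` supported in
`B̄(0, R)`. [folklore] -/
theorem seminorm_coordMul_le (c : V) {f : 𝓢(V, ℂ)} {R : ℝ} (hR : 0 ≤ R)
    (hf : tsupport (f : V → ℂ) ⊆ Metric.closedBall (0 : V) R) (k n : ℕ) :
    SchwartzMap.seminorm ℂ k n (coordMul c f) ≤
      2 ^ n * (‖c‖ * (R + 1)) * (Finset.Iic (k, n)).sup (schwartzSeminormFamily ℂ V ℂ) f := by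
  set g : V → ℂ := fun y => ((⟪y, c⟫ : ℝ) : ℂ) with hgdef
  have hg : g.HasTemperateGrowth := hasTemperateGrowth_inner_ofReal c
  set C : ℝ := ‖c‖ * (R + 1) with hC
  have hC0 : 0 ≤ C := by positivity
  have hsup : 0 ≤ (Finset.Iic (k, n)).sup (schwartzSeminormFamily ℂ V ℂ) f := apply_nonneg _ _
  refine SchwartzMap.seminorm_le_bound ℂ k n _ (by positivity) fun x => ?_
  rw [coordMul, SchwartzMap.smulLeftCLM_apply hg]
  by_cases hx : x ∈ Metric.closedBall (0 : V) R
  · have hleib := norm_iteratedFDeriv_smul_le hg.1 (f.smooth ⊤) x (n := n) (mod_cast le_top)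
    calc ‖x‖ ^ k * ‖iteratedFDeriv ℝ n (fun y => g y • f y) x‖
        ≤ ‖x‖ ^ k * ∑ i ∈ Finset.range (n + 1),
            (n.choose i : ℝ) * ‖iteratedFDeriv ℝ i g x‖ * ‖iteratedFDeriv ℝ (n - i) f x‖ := by
          gcongr
      _ = ∑ i ∈ Finset.range (n + 1), (n.choose i : ℝ) *
            (‖iteratedFDeriv ℝ i g x‖ * (‖x‖ ^ k * ‖iteratedFDeriv ℝ (n - i) f x‖)) := by
          rw [Finset.mul_sum]
          exact Finset.sum_congr rfl fun i _ => by ring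
      _ ≤ ∑ i ∈ Finset.range (n + 1), (n.choose i : ℝ) * (C * (Finset.Iic (k, n)).sup (schwartzSeminormFamily ℂ V ℂ) f) := by
          refine Finset.sum_le_sum fun i _ => mul_le_mul_of_nonneg_left ?_ (by positivity)
          have h1 : ‖iteratedFDeriv ℝ i g x‖ ≤ C := norm_iteratedFDeriv_inner_ofReal_le c hR i hx
          have h2 : ‖x‖ ^ k * ‖iteratedFDeriv ℝ (n - i) f x‖ ≤ (Finset.Iic (k, n)).sup (schwartzSeminormFamily ℂ V ℂ) f :=
            (SchwartzMap.le_seminorm ℂ k (n - i) f x).trans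
              (Seminorm.le_def.1 (Finset.le_sup (f := schwartzSeminormFamily ℂ V ℂ)
                (Finset.mem_Iic.2 (Prod.mk_le_mk.2 ⟨le_rfl, Nat.sub_le n i⟩))) f)
          exact mul_le_mul h1 h2 (by positivity) hC0
      _ = (∑ i ∈ Finset.range (n + 1), (n.choose i : ℝ)) * (C * (Finset.Iic (k, n)).sup (schwartzSeminormFamily ℂ V ℂ) f) := by
          rw [Finset.sum_mul]
      _ = 2 ^ n * (‖c‖ * (R + 1)) * (Finset.Iic (k, n)).sup (schwartzSeminormFamily ℂ V ℂ) f := by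
          rw [← Nat.cast_sum, Nat.sum_range_choose]
          push_cast
          ring
  · have hx' : x ∉ tsupport (fun y => g y • (f : V → ℂ) y) := fun h => hx (hf (tsupport_smul_subset_right g (f : V → ℂ) h))
    have h0 : iteratedFDeriv ℝ n (fun y => g y • f y) x = 0 := by
      by_contra h
      exact hx' (support_iteratedFDeriv_subset n (Function.mem_support.2 h))
    rw [h0, norm_zero, mul_zero]
    positivity

/-- **The coordinate multiplier bound**: `|⟪·, c⟫ f|_M ≤ 2^M ‖c‖ (R + 1) |f|_M` for `f` supported
in `B̄(0, R)`. [folklore] -/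
theorem schwartzNorm_coordMul_le (c : V) {f : 𝓢(V, ℂ)} {R : ℝ} (hR : 0 ≤ R)
    (hf : tsupport (f : V → ℂ) ⊆ Metric.closedBall (0 : V) R) (M : ℕ) :
    schwartzNorm M (coordMul c f) ≤ 2 ^ M * (‖c‖ * (R + 1)) * schwartzNorm M f := by
  change ((Finset.Iic (M, M)).sup (schwartzSeminormFamily ℂ _ ℂ)) _ ≤ _
  have hN0 := QuantumLattice.schwartzNorm_nonneg M f
  refine Seminorm.finset_sup_apply_le (by positivity) fun q hq => ?_
  rw [Finset.mem_Iic] at hq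
  rw [SchwartzMap.schwartzSeminormFamily_apply]
  refine (seminorm_coordMul_le c hR hf q.1 q.2).trans ?_
  have h1 : (2 : ℝ) ^ q.2 ≤ 2 ^ M := pow_le_pow_right₀ (by norm_num) hq.2
  have h2 : (Finset.Iic (q.1, q.2)).sup (schwartzSeminormFamily ℂ V ℂ) f ≤ schwartzNorm M f :=
    Seminorm.le_def.1 (Finset.sup_mono (f := schwartzSeminormFamily ℂ V ℂ)
      (Finset.Iic_subset_Iic.2 (Prod.mk_le_mk.2 ⟨hq.1, hq.2⟩))) f
  have h3 : 0 ≤ (Finset.Iic (q.1, q.2)).sup (schwartzSeminormFamily ℂ V ℂ) f := apply_nonneg _ _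
  gcongr

/-! ### The raw bumps -/

section Bumps

variable [FiniteDimensional ℝ V]

/-- The smooth bump of outer radius `r` (inner radius `r/2`) about the origin. [folklore] -/
def osBump {r : ℝ} (hr : 0 < r) : ContDiffBump (0 : V) := ⟨r / 2, r, half_pos hr, half_lt_self hr⟩

/-- The bump has compact support (as a complex function). [folklore] -/
theorem hasCompactSupport_osBump {r : ℝ} (hr : 0 < r) : HasCompactSupport fun y : V => ((osBump (V := V) hr y : ℝ) : ℂ) :=
  (osBump hr).hasCompactSupport.comp_left Complex.ofReal_zero

/-- The bump is smooth (as a complex function). [folklore] -/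
theorem contDiff_osBump {r : ℝ} (hr : 0 < r) : ContDiff ℝ (⊤ : ℕ∞) fun y : V => ((osBump (V := V) hr y : ℝ) : ℂ) :=
  Complex.ofRealCLM.contDiff.comp (osBump hr).contDiff

/-- **The raw bump of radius `r`** as a Schwartz function (not normalised). [folklore] -/
def rawBumpS {r : ℝ} (hr : 0 < r) : 𝓢(V, ℂ) := (hasCompactSupport_osBump hr).toSchwartzMap (contDiff_osBump hr)

/-- Values of the raw bump. [folklore] -/
theorem rawBumpS_apply {r : ℝ} (hr : 0 < r) (y : V) : rawBumpS hr y = ((osBump (V := V) hr y : ℝ) : ℂ) := rfl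

/-- Support of the raw bump. [folklore] -/
theorem tsupport_rawBumpS_subset {r : ℝ} (hr : 0 < r) : tsupport (rawBumpS (V := V) hr : V → ℂ) ⊆ Metric.closedBall 0 r := by
  rw [show ((rawBumpS (V := V) hr : 𝓢(V, ℂ)) : V → ℂ) = Complex.ofReal ∘ (osBump (V := V) hr) from funext (rawBumpS_apply hr)]
  refine (closure_mono (Function.support_comp_subset Complex.ofReal_zero _)).trans (le_of_eq ?_)
  exact (osBump hr).tsupport_eq

variable [MeasurableSpace V] [BorelSpace V]

/-- **Mass of the raw bump**: `vol B̄(0, r/2) ≤ Re ∫ χ_r` and `∫ χ_r` is real. [folklore] -/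
theorem integral_rawBumpS {r : ℝ} (hr : 0 < r) :
    ∫ y, rawBumpS (V := V) hr y = ((∫ y, osBump (V := V) hr y : ℝ) : ℂ) := by
  simp_rw [rawBumpS_apply]
  exact integral_ofReal

/-- The mass of the raw bump dominates the volume of the inner ball. [folklore] -/
theorem measure_le_integral_osBump {r : ℝ} (hr : 0 < r) :
    (volume (Metric.closedBall (0 : V) (r / 2))).toReal ≤ ∫ y, osBump (V := V) hr y :=
  (osBump (V := V) hr).measure_closedBall_le_integral volume

/-- The mass of the raw bump is positive. [folklore] -/
theorem integral_osBump_pos {r : ℝ} (hr : 0 < r) : 0 < ∫ y, osBump (V := V) hr y := (osBump hr).integral_pos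

omit [MeasurableSpace V] [BorelSpace V] in
/-- **Exact scaling of the raw bumps**: `χ_r = χ₁ ∘ (r⁻¹ ·)`. [folklore] -/
theorem rawBumpS_eq_comp {r : ℝ} (hr : 0 < r) :
    rawBumpS (V := V) hr = SchwartzMap.compCLMOfContinuousLinearEquiv ℂ (invDilation hr.ne') (rawBumpS one_pos) := by
  ext y
  rw [SchwartzMap.compCLMOfContinuousLinearEquiv_apply, Function.comp_apply, rawBumpS_apply, rawBumpS_apply]
  congr 1
  rw [ContDiffBump.apply, ContDiffBump.apply]
  simp only [osBump, sub_zero, invDilation_apply, smul_smul]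
  congr 1
  · field_simp
  · congr 1; field_simp

omit [MeasurableSpace V] [BorelSpace V] in
/-- **Schwartz norms of the raw bumps**: `|χ_r|_M ≤ r^{-M} |χ₁|_M` for `0 < r ≤ 1`. [folklore] -/
theorem schwartzNorm_rawBumpS_le {r : ℝ} (hr : 0 < r) (hr1 : r ≤ 1) (M : ℕ) :
    schwartzNorm M (rawBumpS (V := V) hr) ≤ (r ^ M)⁻¹ * schwartzNorm M (rawBumpS (V := V) one_pos) := by
  rw [rawBumpS_eq_comp hr]
  exact schwartzNorm_compCLM_invDilation_le hr hr1 _ M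

end Bumps

end Literature.MathematicalPhysics.QuantumFieldTheory
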